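import Summits.NavierStokesRegularity.NavierStokesRegularity.Theorems.ExtremiserTransienceNearExtremalTransienceExtremiserLiouvilleDensityLeaf
import Summits.NavierStokesRegularity.NavierStokesRegularity.Theorems.ExtremiserTransienceNearExtremalTransienceExtremiserLiouvilleNoAnalyticExtremalReduction
import Summits.NavierStokesRegularity.NavierStokesRegularity.Theses.ExtremiserTransience
import HarnessLib

/-!
# Route `ExtremiserTransience`, item `HomogeneousSharpConstant` (stmt-NavierStokesRegularity-26686) — PROVED

`--workitem stmt-NavierStokesRegularity-26686`.  Author: prover seat `ns-el-k1b` (g2).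

The L²-class sharp vortex-stretching constant `κ⋆ = sInf V` is universal on the HOMOGENEOUS class (`C^∞`, divergence
free, `‖v‖ ≤ M`, bounded gradient, `D¹v, D²v ∈ L²`, NO `v ∈ L²` clause): `|∫⟪ω, Dv ω⟫| ≤ κ⋆ · M · ‖ω‖₂ ‖∇ω‖₂`.
Proof = `ExtremiserLiouville.extendedSharp_of_density` (g0: «no gain from constants» `noGainFromConstants` + `ε → 0`)
applied to the DENSITY LEAF `ExtremiserLiouville.density_leaf` (this seat: far-field limit, explicit Poincaré-homotopy
solenoidal truncation of `w − c`, `L²` convergence of the truncation errors, `L²`-continuity of `Z, P, S`).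
This settles LINE g4-β's dichotomy on the TRUE side (no Galilean gain at the top: `κ⋆^hom = κ⋆`) and makes K1b of
`Lines/extremiser_liouville` an honest top-of-class rigidity statement; K1b itself is now
⟸ «no analytic extended extremiser with plateau at infinity» alone (`…NoAnalyticExtremalFarFieldGap`).

WHAT THIS IS NOT: not K1b, not the crux NET; a static inequality on admissible fields.  Rung N0 and NS regularity
stay OPEN — nothing here proves NS regularity. [folklore]
-/

noncomputable section

namespace Summit.NavierStokesRegularity.NavierStokesRegularity.Theorems

-- the problem directory repeats the summit name (`NavierStokesRegularity/NavierStokesRegularity`)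
set_option linter.dupNamespace false

/-- **`HomogeneousSharpConstant` (stmt-NavierStokesRegularity-26686) holds**: the sharp depletion constant of the
`L²` class is universal on the homogeneous class (density leaf + no gain from constants). [folklore] -/
theorem homogeneousSharpConstant_proof :
    Summit.NavierStokesRegularity.NavierStokesRegularity.Theses.ExtremiserTransience.HomogeneousSharpConstant := by
  unfold Summit.NavierStokesRegularity.NavierStokesRegularity.Theses.ExtremiserTransience.HomogeneousSharpConstant
  intro v M B hv hdiv hM hB h1 h2
  exact ExtremiserLiouville.extendedSharp_of_density ExtremiserLiouville.density_leaf v M B hv hdiv hM hB h1 h2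

end Summit.NavierStokesRegularity.NavierStokesRegularity.Theorems

end
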